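import Mathlib.Data.ZMod.Basic
import Mathlib.Algebra.BigOperators.Fin
import Mathlib.Data.Fintype.BigOperators
import Mathlib.Data.Fintype.Pi
import Mathlib.Data.Fintype.Prod
import Mathlib.Tactic.Ring
import Mathlib.Tactic.Positivity
import Mathlib.Tactic.FinCases
import HarnessLib

/-!
# The bridge coboundary lemma: an additive functional of a bit-driven finite-state chain that is
# almost surely constant on a terminal event is an exact per-site coboundary in the bulk

SETTING (finite, time-inhomogeneous, "fair-bit form").  A finite state space `S`, deterministic
successor maps `succ t : S → Bool → S` (the bit consumed at time `t` decides the transition), a start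
state `s₀` at time `0`, site functionals `f t : S → ℤ/2`, a terminal set `T ⊆ S` and a horizon `N`.
A bit string `x : Fin N → Bool` drives the trajectory `s_0 = s₀, s_{t+1} = succ t s_t x_t`
(`traj`), and carries the additive functional `Σ_{t ≤ N} f_t(s_t)` (`trajSum`).  REACH(`m`): from
every state at every time `j` (`j + m ≤ N`) every state is reachable in exactly `m` steps (for the
uniform measure on strings this is positivity `≥ 2^{-m}` of the `m`-step kernel).

THEOREM (`bridgeCoboundary`).  If REACH(`m`) holds and the functional is constant `= κ` on the
"bridge" `{x : s_N(x) ∈ T}` up to a fraction `< 2^{-(2m+2)}` of it — precisely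
`2^{2m+2} · #{x : s_N ∈ T, Σ f ≠ κ} < #{x : s_N ∈ T}` — then there are transfer functions
`Φ_t : S → ℤ/2` with `f_j(s) = Φ_j(s) + Φ_{j+1}(succ_j s b)` for EVERY state `s`, EVERY bit `b` and
every bulk time `m ≤ j ≤ N − m − 1`: an exact coboundary on every transition, not merely almost
surely.  (`Φ_j(s)` is the majority value of the prefix sum `Σ_{t<j} f_t(s_t)` over the prefixes
reaching `s` at time `j`; four window-surgery injections show that the minority is empty along every
transition: `min(P⁰,P¹)·Q ≤ 2^N·Bad`, `Tot ≤ 2^m·Q`, `2^N ≤ 2^m·P`, `P^a_j(s) ≤ 2·P^{a+f_j(s)}_{j+1}`.)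
`bridgeCoboundary_local` is the same statement PER TRANSITION with the two uses of REACH(`m`) replaced
by explicit positivity hypotheses (prefix mass `≥ 2^N/C₁` at the source, continuation mass `≥ Tot/C₂`
at the target, `4C₁C₂·Bad < Tot`) — the form needed for translation chains, where REACH fails.

PRINTED RELATIVES.  This is the finite, conditioned ("bridge") and quantitative form of two classical
rigidity statements: Livšic's theorem — a cocycle over a transitive subshift of finite type whose
periodic data vanish (equivalently, which is a measurable coboundary) is a genuine coboundary
[KatokHasselblatt1995, §19.2] — and the lattice statement of Hattori–Takesue that an additive
quantity of finite range with identically vanishing total is a current difference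
[HattoriTakesue1991, §2–§3].  The exact (`ε = 0`) case is path-determinacy of prefix sums; the
`2^{-(2m+2)}`-robust bridge form is not located in print and is SUPPLIED HERE (consumer: cell qa-qnc0,
item `FiniteStateRegisterRigidityFive`, whose Part 1 it is; the state space there is
`ℤ/15 × {0,1}^{2w}`, `m = 2w + 15`).  No named facts.
-/

namespace Literature.Probability.MarkovChains.BridgeCoboundary

open Finset

variable {S : Type*}

/-! ### 1. Bit-driven trajectories -/

section Run

/-- The state at time `j + i` of the trajectory that is in state `s` at time `j` and consumes the bit
`e t` at each time `t ≥ j` (`succ t : S → Bool → S` the successor maps).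
[cite: KatokHasselblatt1995, §19.2 (cocycles over shifts); finite form supplied here] -/
def run (succ : ℕ → S → Bool → S) (j : ℕ) (s : S) (e : ℕ → Bool) : ℕ → S
  | 0 => s
  | i + 1 => succ (j + i) (run succ j s e i) (e (j + i))

variable (succ : ℕ → S → Bool → S)

/-- [cite: KatokHasselblatt1995, §19.2; bookkeeping supplied here] -/
@[simp] theorem run_zero (j : ℕ) (s : S) (e : ℕ → Bool) : run succ j s e 0 = s := rfl

/-- [cite: KatokHasselblatt1995, §19.2; bookkeeping supplied here] -/
theorem run_succ (j : ℕ) (s : S) (e : ℕ → Bool) (i : ℕ) :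
    run succ j s e (i + 1) = succ (j + i) (run succ j s e i) (e (j + i)) := rfl

/-- Trajectories compose: `m + i` steps from time `j` = `i` steps from time `j + k` after `k` steps.
[cite: KatokHasselblatt1995, §19.2; supplied here] -/
theorem run_add (j : ℕ) (s : S) (e : ℕ → Bool) (k i : ℕ) :
    run succ j s e (k + i) = run succ (j + k) (run succ j s e k) e i := by
  induction i with
  | zero => simp
  | succ i ih =>
    show succ (j + (k + i)) (run succ j s e (k + i)) (e (j + (k + i)))
      = succ (j + k + i) (run succ (j + k) (run succ j s e k) e i) (e (j + k + i))
    rw [ih, Nat.add_assoc]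

/-- [cite: KatokHasselblatt1995, §19.2; supplied here] -/
theorem run_split (j : ℕ) (s : S) (e : ℕ → Bool) {k n : ℕ} (hk : k ≤ n) :
    run succ j s e n = run succ (j + k) (run succ j s e k) e (n - k) := by
  obtain ⟨d, rfl⟩ := Nat.exists_eq_add_of_le hk
  rw [run_add, Nat.add_sub_cancel_left]

/-- The state after `n` steps from time `j` only depends on the bits at times `[j, j+n)`.
[cite: KatokHasselblatt1995, §19.2; supplied here] -/
theorem run_congr (j : ℕ) (s : S) {e e' : ℕ → Bool} {n : ℕ}
    (h : ∀ i, j ≤ i → i < j + n → e i = e' i) : run succ j s e n = run succ j s e' n := by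
  induction n with
  | zero => rfl
  | succ n ih =>
    rw [run_succ, run_succ, ih fun i h1 h2 => h i h1 (by omega), h (j + n) (by omega) (by omega)]

end Run

/-! ### 2. Strings of length `N`: environments, windows, splicing -/

section Strings

variable {N : ℕ}

/-- The bit environment of a string of length `N` (bits beyond the horizon are `false`). [folklore] -/
def ext (x : Fin N → Bool) : ℕ → Bool := fun i => if h : i < N then x ⟨i, h⟩ else false

/-- [cite: HattoriTakesue1991, §2 (configurations, local modification, additive quantities); bookkeeping supplied here] -/
theorem ext_apply_of_lt (x : Fin N → Bool) {i : ℕ} (h : i < N) : ext x i = x ⟨i, h⟩ := by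
  simp [ext, h]

/-- Overwrite the window `[k, k+m)` of the string `x` by the word `w`. [folklore] -/
def setWin {m : ℕ} (k : ℕ) (w : Fin m → Bool) (x : Fin N → Bool) : Fin N → Bool :=
  fun i => if h : k ≤ (i : ℕ) ∧ (i : ℕ) < k + m then w ⟨i - k, by omega⟩ else x i

/-- The content of the window `[k, k+m)` of the string `x`. [folklore] -/
def winOf {m : ℕ} (k : ℕ) (hk : k + m ≤ N) (x : Fin N → Bool) : Fin m → Bool :=
  fun i => x ⟨k + i, by omega⟩

/-- [cite: HattoriTakesue1991, §2 (configurations, local modification, additive quantities); bookkeeping supplied here] -/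
theorem ext_setWin_of_not {m : ℕ} (k : ℕ) (w : Fin m → Bool) (x : Fin N → Bool) {i : ℕ}
    (hi : ¬ (k ≤ i ∧ i < k + m)) : ext (setWin k w x) i = ext x i := by
  unfold ext setWin
  by_cases h : i < N
  · simp only [h, ↓reduceDIte, hi]
  · simp only [h, ↓reduceDIte]

/-- [cite: HattoriTakesue1991, §2 (configurations, local modification, additive quantities); bookkeeping supplied here] -/
theorem ext_setWin_of_mem {m : ℕ} (k : ℕ) (hkm : k + m ≤ N) (w : Fin m → Bool)
    (x : Fin N → Bool) {i : ℕ} (h1 : k ≤ i) (h2 : i < k + m) :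
    ext (setWin k w x) i = w ⟨i - k, by omega⟩ := by
  unfold ext setWin
  have : i < N := by omega
  simp only [this, ↓reduceDIte, h1, h2, and_self]

/-- WINDOW SURGERY COUNT: if overwriting the window `[k, k+m)` (by a word that may depend on the string)
maps `src` into `tgt`, then `#src ≤ #tgt · 2^m` — remember the old window content.
[cite: HattoriTakesue1991, §2 (local modifications of configurations); counting form supplied here] -/
theorem card_le_card_mul_of_setWin {m : ℕ} (k : ℕ) (hk : k + m ≤ N)
    (src tgt : Finset (Fin N → Bool)) (w : (Fin N → Bool) → Fin m → Bool)
    (h : ∀ x ∈ src, setWin k (w x) x ∈ tgt) : src.card ≤ tgt.card * 2 ^ m := by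
  classical
  have hcard : (tgt ×ˢ (univ : Finset (Fin m → Bool))).card = tgt.card * 2 ^ m := by
    rw [card_product, card_univ, Fintype.card_fun, Fintype.card_bool, Fintype.card_fin]
  rw [← hcard]
  refine card_le_card_of_injOn (fun x => (setWin k (w x) x, winOf k hk x)) (fun x hx => ?_) ?_
  · exact mem_product.2 ⟨h x hx, mem_univ _⟩
  · intro x _ x' _ hxx'
    simp only [Prod.mk.injEq] at hxx'
    obtain ⟨h1, h2⟩ := hxx'
    funext i
    by_cases hi : k ≤ (i : ℕ) ∧ (i : ℕ) < k + m
    · have e1 := congrFun h2 ⟨(i : ℕ) - k, by omega⟩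
      have e2 : (⟨k + ((i : ℕ) - k), by omega⟩ : Fin N) = i := Fin.ext (by simp only; omega)
      simpa only [winOf, e2] using e1
    · have e1 := congrFun h1 i
      simpa only [setWin, hi, ↓reduceDIte] using e1

/-- Splice two strings at the cut `k`: bits `< k` from `x`, bits `≥ k` from `y`. [folklore] -/
def splice (k : ℕ) (x y : Fin N → Bool) : Fin N → Bool :=
  fun i => if (i : ℕ) < k then x i else y i

/-- [cite: HattoriTakesue1991, §2 (configurations, local modification, additive quantities); bookkeeping supplied here] -/
theorem splice_splice (k : ℕ) (x y : Fin N → Bool) :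
    splice k (splice k x y) (splice k y x) = x := by
  funext i
  unfold splice
  split_ifs <;> rfl

/-- [cite: HattoriTakesue1991, §2 (configurations, local modification, additive quantities); bookkeeping supplied here] -/
theorem ext_splice_of_lt (k : ℕ) (x y : Fin N → Bool) {i : ℕ} (hi : i < k) :
    ext (splice k x y) i = ext x i := by
  unfold ext splice
  by_cases h : i < N <;> simp [h, hi]

/-- [cite: HattoriTakesue1991, §2 (configurations, local modification, additive quantities); bookkeeping supplied here] -/
theorem ext_splice_of_le (k : ℕ) (x y : Fin N → Bool) {i : ℕ} (hi : k ≤ i) :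
    ext (splice k x y) i = ext y i := by
  unfold ext splice
  have : ¬ i < k := by omega
  by_cases h : i < N <;> simp [h, this]

/-- SPLICE COUNT: for a set `A` of strings determined by the bits `< k` and a set `B` determined by the
bits `≥ k`, `#A · #B ≤ #(A ∩ B) · 2^N` (splicing is injective together with the reverse splice).
[cite: HattoriTakesue1991, §2; counting form supplied here] -/
theorem card_mul_card_le_of_splice (k : ℕ) (A B : Finset (Fin N → Bool))
    (hA : ∀ x y, x ∈ A → splice k x y ∈ A) (hB : ∀ x y, y ∈ B → splice k x y ∈ B) :
    A.card * B.card ≤ (A ∩ B).card * 2 ^ N := by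
  classical
  have h1 : (A ×ˢ B).card = A.card * B.card := card_product _ _
  have h2 : ((A ∩ B) ×ˢ (univ : Finset (Fin N → Bool))).card = (A ∩ B).card * 2 ^ N := by
    rw [card_product, card_univ, Fintype.card_fun, Fintype.card_bool, Fintype.card_fin]
  rw [← h1, ← h2]
  refine card_le_card_of_injOn (fun p => (splice k p.1 p.2, splice k p.2 p.1)) (fun p hp => ?_) ?_
  · have hp' : p ∈ A ×ˢ B := hp
    rw [mem_product] at hp'
    exact mem_product.2 ⟨mem_inter.2 ⟨hA _ _ hp'.1, hB _ _ hp'.2⟩, mem_univ _⟩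
  · intro p _ q _ hpq
    simp only [Prod.mk.injEq] at hpq
    have e1 := congrArg₂ (splice k) hpq.1 hpq.2
    have e2 := congrArg₂ (splice k) hpq.2 hpq.1
    rw [splice_splice, splice_splice] at e1 e2
    exact Prod.ext e1 e2

end Strings

/-! ### 3. Trajectories of strings, prefix sums, the functional -/

section Traj

variable {N : ℕ} (succ : ℕ → S → Bool → S) (s₀ : S) (f : ℕ → S → ZMod 2)

/-- The state at time `k` of the trajectory driven by the string `x` from `s₀` at time `0`.
[cite: KatokHasselblatt1995, §19.2; supplied here] -/
def traj (x : Fin N → Bool) (k : ℕ) : S := run succ 0 s₀ (ext x) k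

/-- The additive functional `Σ_{t ≤ N} f_t(s_t)` of the trajectory (terminal site included).
[cite: HattoriTakesue1991, §2 (additive quantities); supplied here] -/
def trajSum (x : Fin N → Bool) : ZMod 2 := ∑ i ∈ range (N + 1), f i (traj succ s₀ x i)

/-- Prefix sums `Σ_{t<k} f_t(s_t)`. [cite: HattoriTakesue1991, §2; supplied here] -/
def preSum (x : Fin N → Bool) (k : ℕ) : ZMod 2 := ∑ i ∈ range k, f i (traj succ s₀ x i)

/-- Suffix sums `Σ_{k ≤ t ≤ N} f_t` along the trajectory restarted in state `r` at time `k`. [folklore] -/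
private def sufSum (r : S) (k : ℕ) (x : Fin N → Bool) : ZMod 2 :=
  ∑ i ∈ range (N + 1 - k), f (k + i) (run succ k r (ext x) i)

/-- [folklore] -/
private theorem sum_range_split' {M : Type*} [AddCommMonoid M] (g : ℕ → M) {k n : ℕ} (hk : k ≤ n) :
    ∑ i ∈ range n, g i = ∑ i ∈ range k, g i + ∑ i ∈ range (n - k), g (k + i) := by
  obtain ⟨d, rfl⟩ := Nat.exists_eq_add_of_le hk
  rw [sum_range_add, Nat.add_sub_cancel_left]

/-- [cite: HattoriTakesue1991, §2 (configurations, local modification, additive quantities); bookkeeping supplied here] -/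
theorem traj_congr {x y : Fin N → Bool} {k : ℕ} (h : ∀ i, i < k → ext x i = ext y i) {i : ℕ}
    (hi : i ≤ k) : traj succ s₀ x i = traj succ s₀ y i :=
  run_congr succ 0 s₀ fun t _ ht => h t (by omega)

/-- [cite: HattoriTakesue1991, §2 (configurations, local modification, additive quantities); bookkeeping supplied here] -/
theorem preSum_congr {x y : Fin N → Bool} {k : ℕ} (h : ∀ i, i < k → ext x i = ext y i) :
    preSum succ s₀ f x k = preSum succ s₀ f y k :=
  sum_congr rfl fun i hi => by rw [traj_congr succ s₀ h (mem_range.1 hi).le]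

/-- [cite: HattoriTakesue1991, §2 (configurations, local modification, additive quantities); bookkeeping supplied here] -/
theorem traj_add (x : Fin N → Bool) (k i : ℕ) :
    traj succ s₀ x (k + i) = run succ k (traj succ s₀ x k) (ext x) i := by
  unfold traj; rw [run_add, Nat.zero_add]

/-- [cite: HattoriTakesue1991, §2 (configurations, local modification, additive quantities); bookkeeping supplied here] -/
theorem traj_split (x : Fin N → Bool) {k n : ℕ} (hk : k ≤ n) :
    traj succ s₀ x n = run succ k (traj succ s₀ x k) (ext x) (n - k) := by
  unfold traj; rw [run_split succ 0 s₀ (ext x) hk, Nat.zero_add]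

/-- [cite: HattoriTakesue1991, §2 (configurations, local modification, additive quantities); bookkeeping supplied here] -/
theorem traj_succ' (x : Fin N → Bool) (k : ℕ) :
    traj succ s₀ x (k + 1) = succ k (traj succ s₀ x k) (ext x k) := by
  unfold traj; rw [run_succ, Nat.zero_add]

/-- [cite: HattoriTakesue1991, §2 (configurations, local modification, additive quantities); bookkeeping supplied here] -/
theorem preSum_succ (x : Fin N → Bool) (k : ℕ) :
    preSum succ s₀ f x (k + 1) = preSum succ s₀ f x k + f k (traj succ s₀ x k) := by
  unfold preSum; rw [sum_range_succ]

/-- The functional splits at a cut: prefix sum plus the suffix sum restarted at the current state.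
[folklore] -/
private theorem trajSum_eq_preSum_add_sufSum (x : Fin N → Bool) {k : ℕ} (hk : k ≤ N) :
    trajSum succ s₀ f x = preSum succ s₀ f x k + sufSum succ f (traj succ s₀ x k) k x := by
  unfold trajSum preSum sufSum
  rw [sum_range_split' _ (show k ≤ N + 1 by omega)]
  congr 1
  exact sum_congr rfl fun i _ => by rw [traj_add]

/-- [folklore] -/
private theorem sufSum_congr (r : S) {k : ℕ} {x y : Fin N → Bool}
    (h : ∀ i, k ≤ i → ext x i = ext y i) : sufSum succ f r k x = sufSum succ f r k y :=
  sum_congr rfl fun i _ => congrArg _ (run_congr succ k r (n := i) fun t ht _ => h t ht)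

end Traj

/-! ### 4. The bridge coboundary lemma -/

section Main

variable [DecidableEq S] {N m : ℕ} (succ : ℕ → S → Bool → S) (s₀ : S)
  (f : ℕ → S → ZMod 2) (T : Finset S) (κ : ZMod 2)

/-- Prefix class counts `P^a_k(r) = #{x : s_k(x) = r, Σ_{t<k} f_t = a}`. [folklore] -/
private def pcount (k : ℕ) (r : S) (a : ZMod 2) : ℕ :=
  (univ.filter fun x : Fin N → Bool => traj succ s₀ x k = r ∧ preSum succ s₀ f x k = a).card

/-- Continuation counts `Q_k(r) = #{x : the trajectory restarted at (k, r) ends in T}`. [folklore] -/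
private def qcount (k : ℕ) (r : S) : ℕ :=
  (univ.filter fun x : Fin N → Bool => run succ k r (ext x) (N - k) ∈ T).card

/-- The bridge `{x : s_N(x) ∈ T}`. [folklore] -/
private def totSet : Finset (Fin N → Bool) := univ.filter fun x => traj succ s₀ x N ∈ T

/-- The deviation set `{x : s_N(x) ∈ T, Σ f ≠ κ}`. [folklore] -/
private def badSet : Finset (Fin N → Bool) :=
  univ.filter fun x => traj succ s₀ x N ∈ T ∧ trajSum succ s₀ f x ≠ κ

/-- (F1) `P^v_k(r) · Q_k(r) ≤ 2^N · Bad` whenever `v` is a (weak) minority prefix value at `(k, r)`.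
[folklore] -/
private theorem pcount_mul_qcount_le {k : ℕ} (hk : k ≤ N) (r : S) (v : ZMod 2)
    (hv : pcount (N := N) succ s₀ f k r v ≤ pcount (N := N) succ s₀ f k r (v + 1)) :
    pcount (N := N) succ s₀ f k r v * qcount (N := N) succ T k r
      ≤ 2 ^ N * (badSet (N := N) succ s₀ f T κ).card := by
  classical
  -- A_a = prefix class a at (k,r); B_a = continuations ending in T with suffix sum ≠ κ - a
  set A : ZMod 2 → Finset (Fin N → Bool) := fun a =>
    univ.filter fun x => traj succ s₀ x k = r ∧ preSum succ s₀ f x k = a with hA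
  set B : ZMod 2 → Finset (Fin N → Bool) := fun a =>
    univ.filter fun x => run succ k r (ext x) (N - k) ∈ T ∧ sufSum succ f r k x ≠ κ - a with hB
  have memA : ∀ a x, x ∈ A a ↔ (traj succ s₀ x k = r ∧ preSum succ s₀ f x k = a) := by
    intro a x; rw [hA]; simp only [mem_filter, mem_univ, true_and]
  have memB : ∀ a x, x ∈ B a ↔
      (run succ k r (ext x) (N - k) ∈ T ∧ sufSum succ f r k x ≠ κ - a) := by
    intro a x; rw [hB]; simp only [mem_filter, mem_univ, true_and]
  have hAc : ∀ a, (A a).card = pcount (N := N) succ s₀ f k r a := fun a => rfl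
  -- splice stability
  have hAs : ∀ a x y, x ∈ A a → splice k x y ∈ A a := by
    intro a x y hx
    rw [memA] at hx ⊢
    have hc : ∀ i, i < k → ext (splice k x y) i = ext x i := fun i hi => ext_splice_of_lt k x y hi
    refine ⟨?_, ?_⟩
    · rw [traj_congr succ s₀ hc le_rfl]; exact hx.1
    · rw [preSum_congr succ s₀ f hc]; exact hx.2
  have hBs : ∀ a x y, y ∈ B a → splice k x y ∈ B a := by
    intro a x y hy
    rw [memB] at hy ⊢
    have hc : ∀ i, k ≤ i → ext (splice k x y) i = ext y i := fun i hi => ext_splice_of_le k x y hi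
    refine ⟨?_, ?_⟩
    · rw [run_congr succ k r (n := N - k) (fun t ht _ => hc t ht)]; exact hy.1
    · rw [sufSum_congr succ f r hc]; exact hy.2
  -- A_a ∩ B_a ⊆ Bad ∩ {preSum = a}
  have hsub : ∀ a, A a ∩ B a ⊆ (badSet (N := N) succ s₀ f T κ).filter
      fun x => preSum succ s₀ f x k = a := by
    intro a x hx
    rw [mem_inter, memA, memB] at hx
    obtain ⟨⟨hxr, hxa⟩, ⟨hxT, hxs⟩⟩ := hx
    unfold badSet
    rw [mem_filter, mem_filter]
    refine ⟨⟨mem_univ _, ?_, ?_⟩, hxa⟩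
    · rw [traj_split succ s₀ x hk, hxr]; exact hxT
    · rw [trajSum_eq_preSum_add_sufSum succ s₀ f x hk, hxr, hxa]
      intro h
      exact hxs (by rw [← h, add_sub_cancel_left])
  have key : ∀ z c w : ZMod 2, (z ≠ c - (w + 1)) ↔ (z = c - w) := by decide
  have hB01 : (B v).card + (B (v + 1)).card = qcount (N := N) succ T k r := by
    have e1 : B v = (univ.filter fun x : Fin N → Bool => run succ k r (ext x) (N - k) ∈ T).filter
        (fun x => sufSum succ f r k x ≠ κ - v) := by
      rw [hB]; simp only [filter_filter]
    have e2 : B (v + 1) = (univ.filter fun x : Fin N → Bool => run succ k r (ext x) (N - k) ∈ T).filter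
        (fun x => ¬ (sufSum succ f r k x ≠ κ - v)) := by
      rw [hB]; simp only [filter_filter, not_not]
      exact filter_congr fun x _ => by rw [key]
    rw [e1, e2, card_filter_add_card_filter_not]
    rfl
  have key2 : ∀ w : ZMod 2, w ≠ w + 1 := by decide
  have hbad : ((badSet (N := N) succ s₀ f T κ).filter fun x => preSum succ s₀ f x k = v).card
      + ((badSet (N := N) succ s₀ f T κ).filter fun x => preSum succ s₀ f x k = v + 1).card
      ≤ (badSet (N := N) succ s₀ f T κ).card := by
    rw [← card_union_of_disjoint]
    · exact card_le_card (union_subset (filter_subset _ _) (filter_subset _ _))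
    · rw [disjoint_filter]
      intro x _ h1 h2
      exact key2 v (h1.symm.trans h2)
  have h0 := card_mul_card_le_of_splice k (A v) (B v) (hAs v) (hBs v)
  have h1 := card_mul_card_le_of_splice k (A (v + 1)) (B (v + 1)) (hAs _) (hBs _)
  have h0' := card_le_card (hsub v)
  have h1' := card_le_card (hsub (v + 1))
  rw [hAc] at h0 h1
  calc pcount succ s₀ f k r v * qcount succ T k r
      = pcount succ s₀ f k r v * (B v).card + pcount succ s₀ f k r v * (B (v + 1)).card := by
        rw [← hB01, Nat.mul_add]
    _ ≤ pcount succ s₀ f k r v * (B v).card + pcount succ s₀ f k r (v + 1) * (B (v + 1)).card :=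
        Nat.add_le_add_left (Nat.mul_le_mul_right _ hv) _
    _ ≤ (A v ∩ B v).card * 2 ^ N + (A (v + 1) ∩ B (v + 1)).card * 2 ^ N := Nat.add_le_add h0 h1
    _ ≤ 2 ^ N * (badSet succ s₀ f T κ).card := by
        rw [← Nat.add_mul, Nat.mul_comm]
        exact Nat.mul_le_mul_left _ ((Nat.add_le_add h0' h1').trans hbad)

/-- (F2) `Tot ≤ 2^m · Q_k(r)` for `k + m ≤ N` (drive `r` to the actual state at time `k+m`). [folklore] -/
private theorem tot_le_qcount (hreach : ∀ j (s s' : S), j + m ≤ N → ∃ e : ℕ → Bool, run succ j s e m = s')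
    {k : ℕ} (hk : k + m ≤ N) (r : S) :
    (totSet (N := N) succ s₀ T).card ≤ qcount (N := N) succ T k r * 2 ^ m := by
  classical
  choose e he using hreach
  refine card_le_card_mul_of_setWin k hk _ _
    (fun x => fun i => e k r (traj succ s₀ x (k + m)) hk (k + i)) fun x hx => ?_
  unfold totSet at hx
  rw [mem_filter] at hx ⊢
  refine ⟨mem_univ _, ?_⟩
  set x' := setWin k (fun i : Fin m => e k r (traj succ s₀ x (k + m)) hk (k + i)) x with hx'
  have hmid : run succ k r (ext x') m = traj succ s₀ x (k + m) := by
    rw [← he k r (traj succ s₀ x (k + m)) hk]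
    refine run_congr succ k r fun i h1 h2 => ?_
    rw [hx', ext_setWin_of_mem k hk _ x h1 h2]
    congr 1; dsimp only; omega
  rw [run_split succ k r (ext x') (show m ≤ N - k by omega), hmid,
    show N - k - m = N - (k + m) by omega]
  have htail : run succ (k + m) (traj succ s₀ x (k + m)) (ext x') (N - (k + m))
      = run succ (k + m) (traj succ s₀ x (k + m)) (ext x) (N - (k + m)) :=
    run_congr succ _ _ fun i h1 _ => by rw [hx', ext_setWin_of_not k _ x (by omega)]
  rw [htail, ← traj_split succ s₀ x hk]
  exact hx.2

/-- (F3) `2^N ≤ 2^m · P_k(r)` for `m ≤ k ≤ N` (drive the state at time `k − m` to `r`). [folklore] -/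
private theorem two_pow_le_pcount (hreach : ∀ j (s s' : S), j + m ≤ N → ∃ e : ℕ → Bool, run succ j s e m = s')
    {k : ℕ} (hmk : m ≤ k) (hk : k ≤ N) (r : S) :
    2 ^ N ≤ (pcount (N := N) succ s₀ f k r 0 + pcount (N := N) succ s₀ f k r 1) * 2 ^ m := by
  classical
  choose e he using hreach
  have hkm : k - m + m ≤ N := by omega
  have hP : pcount (N := N) succ s₀ f k r 0 + pcount (N := N) succ s₀ f k r 1
      = (univ.filter fun x : Fin N → Bool => traj succ s₀ x k = r).card := by
    unfold pcount
    have key4 : ∀ z : ZMod 2, (¬ z = 0) ↔ z = 1 := by decide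
    rw [← card_filter_add_card_filter_not (s := univ.filter fun x : Fin N → Bool =>
      traj succ s₀ x k = r) (p := fun x => preSum succ s₀ f x k = 0), filter_filter, filter_filter]
    congr 2
    exact filter_congr fun x _ => by rw [key4]
  rw [hP]
  have := card_le_card_mul_of_setWin (k - m) hkm (univ : Finset (Fin N → Bool))
    (univ.filter fun x : Fin N → Bool => traj succ s₀ x k = r)
    (fun x => fun i => e (k - m) (traj succ s₀ x (k - m)) r hkm (k - m + i)) fun x _ => ?_
  · simpa only [card_univ, Fintype.card_fun, Fintype.card_bool, Fintype.card_fin] using this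
  rw [mem_filter]
  refine ⟨mem_univ _, ?_⟩
  set x' := setWin (k - m) (fun i : Fin m => e (k - m) (traj succ s₀ x (k - m)) r hkm (k - m + i)) x
    with hx'
  rw [traj_split succ s₀ x' (show k - m ≤ k by omega), show k - (k - m) = m by omega]
  have hpre : traj succ s₀ x' (k - m) = traj succ s₀ x (k - m) :=
    traj_congr succ s₀ (fun i hi => by rw [hx', ext_setWin_of_not (k - m) _ x (by omega)]) le_rfl
  rw [hpre, ← he (k - m) (traj succ s₀ x (k - m)) r hkm]
  refine run_congr succ _ _ fun i h1 h2 => ?_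
  rw [hx', ext_setWin_of_mem (k - m) hkm _ x h1 h2]
  congr 1; dsimp only; omega

/-- (F4) `P^a_j(s) ≤ 2 · P^{a + f_j(s)}_{j+1}(succ_j s b)` (set the bit at time `j` to `b`). [folklore] -/
private theorem pcount_le_two_mul {j : ℕ} (hj : j + 1 ≤ N) (s : S) (a : ZMod 2) (b : Bool) :
    pcount (N := N) succ s₀ f j s a
      ≤ pcount (N := N) succ s₀ f (j + 1) (succ j s b) (a + f j s) * 2 ^ 1 := by
  classical
  refine card_le_card_mul_of_setWin j hj _ _ (fun _ => fun _ : Fin 1 => b) fun x hx => ?_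
  rw [mem_filter] at hx ⊢
  obtain ⟨_, hxs, hxa⟩ := hx
  set x' := setWin j (fun _ : Fin 1 => b) x with hx'
  have hc : ∀ i, i < j → ext x' i = ext x i := fun i hi => by
    rw [hx', ext_setWin_of_not j _ x (by omega)]
  have h1 : traj succ s₀ x' j = s := by rw [traj_congr succ s₀ hc le_rfl, hxs]
  have h2 : ext x' j = b := by rw [hx', ext_setWin_of_mem j hj _ x le_rfl (by omega)]
  refine ⟨mem_univ _, ?_, ?_⟩
  · rw [traj_succ', h1, h2]
  · rw [preSum_succ, preSum_congr succ s₀ f hc, hxa, h1]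

/-- **Bridge coboundary lemma.**  Bit-driven finite-state chain with `m`-step reachability; if the
additive functional `Σ_{t ≤ N} f_t(s_t)` differs from `κ` on fewer than a `2^{-(2m+2)}` fraction of
the bridge `{s_N ∈ T}`, then on every bulk transition (`m ≤ j`, `j + m + 1 ≤ N`, every state, both
bits) `f_j` is an exact coboundary: `f_j(s) = Φ_j(s) + Φ_{j+1}(succ_j s b)`.
[cite: KatokHasselblatt1995, §19.2 (Livšic: measurable/periodic-data coboundaries are genuine
coboundaries); HattoriTakesue1991, §2–§3 (additive conserved quantities are current differences);
finite bridge form with explicit constant supplied here (qa-qnc0 ROUND-31, PROOF-FS §2)] -/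
theorem bridgeCoboundary
    (hreach : ∀ j (s s' : S), j + m ≤ N → ∃ e : ℕ → Bool, run succ j s e m = s')
    (hε : 2 ^ (2 * m + 2) * (univ.filter fun x : Fin N → Bool =>
        traj succ s₀ x N ∈ T ∧ trajSum succ s₀ f x ≠ κ).card
      < (univ.filter fun x : Fin N → Bool => traj succ s₀ x N ∈ T).card) :
    ∃ Φ : ℕ → S → ZMod 2, ∀ j (s : S) (b : Bool), m ≤ j → j + m + 1 ≤ N →
      f j s = Φ j s + Φ (j + 1) (succ j s b) := by
  classical
  -- Φ_k(r) := the (weak) majority value of the prefix sum at (k, r)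
  let P : ℕ → S → ZMod 2 → ℕ := fun k r a => pcount (N := N) succ s₀ f k r a
  let Φ : ℕ → S → ZMod 2 := fun k r => if P k r 0 < P k r 1 then 1 else 0
  refine ⟨Φ, fun j s b hmj hjN => ?_⟩
  -- notation
  set Bad := (badSet (N := N) succ s₀ f T κ).card with hBad
  set Tot := (totSet (N := N) succ s₀ T).card with hTot
  have hε' : 2 ^ (2 * m + 2) * Bad < Tot := hε
  -- majority facts
  have key3 : ∀ w : ZMod 2, w + 1 + 1 = w := by decide
  have hmaj : ∀ k r, P k r (Φ k r + 1) ≤ P k r (Φ k r) := by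
    intro k r
    by_cases h : P k r 0 < P k r 1
    · simp only [Φ, h, ↓reduceIte]
      rw [show (1 : ZMod 2) + 1 = 0 by decide]; exact h.le
    · simp only [Φ, h, ↓reduceIte, zero_add]; exact not_lt.1 h
  have hmaj2 : ∀ k r, P k r 0 + P k r 1 ≤ 2 * P k r (Φ k r) := by
    intro k r
    by_cases h : P k r 0 < P k r 1
    · simp only [Φ, h, ↓reduceIte]; omega
    · simp only [Φ, h, ↓reduceIte]; omega
  by_contra hne
  -- the value v := Φ_j(s) + f_j(s) is then the minority value at (j+1, s')
  set s' := succ j s b with hs'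
  set v : ZMod 2 := Φ j s + f j s with hv
  have hv' : Φ (j + 1) s' = v + 1 := by
    have h01 : ∀ z w : ZMod 2, z ≠ w → z = w + 1 := by decide
    apply h01
    intro h
    have h2 : ∀ z : ZMod 2, z + z = 0 := by decide
    exact hne (by rw [hv] at h; rw [h, ← add_assoc, h2, zero_add])
  have hmin : P (j + 1) s' v ≤ P (j + 1) s' (v + 1) := by
    have := hmaj (j + 1) s'
    rw [hv', key3] at this
    exact this
  -- (F4): the majority class at (j, s) feeds the class v at (j+1, s')
  have hF4 : P j s (Φ j s) ≤ P (j + 1) s' v * 2 :=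
    (pcount_le_two_mul succ s₀ f (show j + 1 ≤ N by omega) s (Φ j s) b).trans (by rw [pow_one])
  -- (F3) at (j, s)
  have hF3 : 2 ^ N ≤ (P j s 0 + P j s 1) * 2 ^ m :=
    two_pow_le_pcount succ s₀ f hreach hmj (by omega) s
  -- (F1) at (j+1, s') with the minority value v, and (F2) at (j+1, s')
  have hF1 : P (j + 1) s' v * qcount (N := N) succ T (j + 1) s' ≤ 2 ^ N * Bad :=
    pcount_mul_qcount_le succ s₀ f T κ (show j + 1 ≤ N by omega) s' v hmin
  have hF2 : Tot ≤ qcount (N := N) succ T (j + 1) s' * 2 ^ m :=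
    tot_le_qcount succ s₀ T hreach (show j + 1 + m ≤ N by omega) s'
  -- arithmetic
  set Q := qcount (N := N) succ T (j + 1) s' with hQ
  have h1 : 2 ^ N ≤ 2 * P j s (Φ j s) * 2 ^ m := by
    calc 2 ^ N ≤ (P j s 0 + P j s 1) * 2 ^ m := hF3
      _ ≤ 2 * P j s (Φ j s) * 2 ^ m := Nat.mul_le_mul_right _ (hmaj2 j s)
  have h2 : 2 ^ N ≤ 4 * P (j + 1) s' v * 2 ^ m := by
    calc 2 ^ N ≤ 2 * P j s (Φ j s) * 2 ^ m := h1
      _ ≤ 2 * (P (j + 1) s' v * 2) * 2 ^ m :=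
          Nat.mul_le_mul_right _ (Nat.mul_le_mul_left _ hF4)
      _ = 4 * P (j + 1) s' v * 2 ^ m := by ring
  have h3 : 2 ^ N * Tot ≤ 4 * 2 ^ m * 2 ^ m * (2 ^ N * Bad) := by
    calc 2 ^ N * Tot ≤ (4 * P (j + 1) s' v * 2 ^ m) * (Q * 2 ^ m) := Nat.mul_le_mul h2 hF2
      _ = 4 * 2 ^ m * 2 ^ m * (P (j + 1) s' v * Q) := by ring
      _ ≤ 4 * 2 ^ m * 2 ^ m * (2 ^ N * Bad) := Nat.mul_le_mul_left _ hF1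
  have h4 : 2 ^ N * Tot ≤ 2 ^ N * (2 ^ (2 * m + 2) * Bad) := by
    calc 2 ^ N * Tot ≤ 4 * 2 ^ m * 2 ^ m * (2 ^ N * Bad) := h3
      _ = 2 ^ N * (2 ^ (2 * m + 2) * Bad) := by ring
  have h5 : Tot ≤ 2 ^ (2 * m + 2) * Bad := Nat.le_of_mul_le_mul_left h4 (by positivity)
  exact absurd hε' (not_lt.2 h5)

/-! ### 5. The local form: per-transition positivity instead of reachability -/

/-- **Bridge coboundary lemma, LOCAL form.**  Same chain, functional and bridge; NO reachability
hypothesis.  There is ONE family of transfer functions `Φ_t : S → ℤ/2` (the prefix majorities) such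
that, for any constants `C₁, C₂` with `4·C₁·C₂·#{s_N ∈ T, Σ f ≠ κ} < #{s_N ∈ T}`, the coboundary
identity `f_j(s) = Φ_j(s) + Φ_{j+1}(succ_j s b)` holds for EVERY transition `(j, s, b)` whose source
has prefix mass `#{x : s_j(x) = s} ≥ 2^N / C₁` and whose target has continuation mass
`#{x : the walk restarted at (j+1, succ_j s b) ends in T} ≥ #{s_N ∈ T} / C₂`.  (`bridgeCoboundary` is
the case `C₁ = C₂ = 2^m` supplied by REACH(`m`); for translation chains `s ↦ s + b·τ_j` on an abelian
group REACH fails and the two positivity facts come from equidistribution instead — the form requested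
by the cell qa-qnc0, item `MultiCounterRungFive`, plan (α2).)
[cite: KatokHasselblatt1995, §19.2 (Livšic); HattoriTakesue1991, §2–§3; local finite form supplied here (qa-qnc0 ROUND-32 §3 (α2))] -/
theorem bridgeCoboundary_local :
    ∃ Φ : ℕ → S → ZMod 2, ∀ (C₁ C₂ : ℕ),
      4 * C₁ * C₂ * (univ.filter fun x : Fin N → Bool =>
          traj succ s₀ x N ∈ T ∧ trajSum succ s₀ f x ≠ κ).card
        < (univ.filter fun x : Fin N → Bool => traj succ s₀ x N ∈ T).card →
      ∀ j (s : S) (b : Bool), j + 1 ≤ N →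
        2 ^ N ≤ C₁ * (univ.filter fun x : Fin N → Bool => traj succ s₀ x j = s).card →
        (univ.filter fun x : Fin N → Bool => traj succ s₀ x N ∈ T).card
          ≤ C₂ * (univ.filter fun x : Fin N → Bool =>
              run succ (j + 1) (succ j s b) (ext x) (N - (j + 1)) ∈ T).card →
        f j s = Φ j s + Φ (j + 1) (succ j s b) := by
  classical
  let P : ℕ → S → ZMod 2 → ℕ := fun k r a => pcount (N := N) succ s₀ f k r a
  let Φ : ℕ → S → ZMod 2 := fun k r => if P k r 0 < P k r 1 then 1 else 0
  refine ⟨Φ, fun C₁ C₂ hε j s b hjN hPm hQm => ?_⟩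
  set Bad := (badSet (N := N) succ s₀ f T κ).card with hBad
  set Tot := (totSet (N := N) succ s₀ T).card with hTot
  have hε' : 4 * C₁ * C₂ * Bad < Tot := hε
  have hQ' : Tot ≤ C₂ * qcount (N := N) succ T (j + 1) (succ j s b) := hQm
  -- the prefix mass splits into the two prefix classes
  have hsplit : (univ.filter fun x : Fin N → Bool => traj succ s₀ x j = s).card = P j s 0 + P j s 1 := by
    show _ = pcount (N := N) succ s₀ f j s 0 + pcount (N := N) succ s₀ f j s 1
    unfold pcount
    have key4 : ∀ z : ZMod 2, (¬ z = 0) ↔ z = 1 := by decide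
    rw [← card_filter_add_card_filter_not (s := univ.filter fun x : Fin N → Bool =>
      traj succ s₀ x j = s) (p := fun x => preSum succ s₀ f x j = 0), filter_filter, filter_filter]
    congr 2
    exact filter_congr fun x _ => by rw [key4]
  rw [hsplit] at hPm
  -- majority facts
  have key3 : ∀ w : ZMod 2, w + 1 + 1 = w := by decide
  have hmaj : ∀ k r, P k r (Φ k r + 1) ≤ P k r (Φ k r) := by
    intro k r
    by_cases h : P k r 0 < P k r 1
    · simp only [Φ, h, ↓reduceIte]
      rw [show (1 : ZMod 2) + 1 = 0 by decide]; exact h.le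
    · simp only [Φ, h, ↓reduceIte, zero_add]; exact not_lt.1 h
  have hmaj2 : ∀ k r, P k r 0 + P k r 1 ≤ 2 * P k r (Φ k r) := by
    intro k r
    by_cases h : P k r 0 < P k r 1
    · simp only [Φ, h, ↓reduceIte]; omega
    · simp only [Φ, h, ↓reduceIte]; omega
  by_contra hne
  set s' := succ j s b with hs'
  set v : ZMod 2 := Φ j s + f j s with hv
  have hv' : Φ (j + 1) s' = v + 1 := by
    have h01 : ∀ z w : ZMod 2, z ≠ w → z = w + 1 := by decide
    apply h01
    intro h
    have h2 : ∀ z : ZMod 2, z + z = 0 := by decide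
    exact hne (by rw [hv] at h; rw [h, ← add_assoc, h2, zero_add])
  have hmin : P (j + 1) s' v ≤ P (j + 1) s' (v + 1) := by
    have := hmaj (j + 1) s'
    rw [hv', key3] at this
    exact this
  have hF4 : P j s (Φ j s) ≤ P (j + 1) s' v * 2 :=
    (pcount_le_two_mul succ s₀ f hjN s (Φ j s) b).trans (by rw [pow_one])
  have hF1 : P (j + 1) s' v * qcount (N := N) succ T (j + 1) s' ≤ 2 ^ N * Bad :=
    pcount_mul_qcount_le succ s₀ f T κ hjN s' v hmin
  set Q := qcount (N := N) succ T (j + 1) s' with hQ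
  have h1 : 2 ^ N ≤ C₁ * (2 * P j s (Φ j s)) := hPm.trans (Nat.mul_le_mul_left _ (hmaj2 j s))
  have h2 : 2 ^ N ≤ 4 * C₁ * P (j + 1) s' v := by
    calc 2 ^ N ≤ C₁ * (2 * P j s (Φ j s)) := h1
      _ ≤ C₁ * (2 * (P (j + 1) s' v * 2)) :=
          Nat.mul_le_mul_left _ (Nat.mul_le_mul_left _ hF4)
      _ = 4 * C₁ * P (j + 1) s' v := by ring
  have h3 : 2 ^ N * Tot ≤ 4 * C₁ * C₂ * (2 ^ N * Bad) := by
    calc 2 ^ N * Tot ≤ (4 * C₁ * P (j + 1) s' v) * (C₂ * Q) := Nat.mul_le_mul h2 hQ'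
      _ = 4 * C₁ * C₂ * (P (j + 1) s' v * Q) := by ring
      _ ≤ 4 * C₁ * C₂ * (2 ^ N * Bad) := Nat.mul_le_mul_left _ hF1
  have h4 : 2 ^ N * Tot ≤ 2 ^ N * (4 * C₁ * C₂ * Bad) := by
    calc 2 ^ N * Tot ≤ 4 * C₁ * C₂ * (2 ^ N * Bad) := h3
      _ = 2 ^ N * (4 * C₁ * C₂ * Bad) := by ring
  have h5 : Tot ≤ 4 * C₁ * C₂ * Bad := Nat.le_of_mul_le_mul_left h4 (by positivity)
  exact absurd hε' (not_lt.2 h5)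

end Main

end Literature.Probability.MarkovChains.BridgeCoboundary
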